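import Literature.AlgebraicGeometry.Motives.VarietiesGeometricallyIntegralProofs
import Mathlib.AlgebraicGeometry.Morphisms.Smooth
import Mathlib.AlgebraicGeometry.Noetherian
import Mathlib.RingTheory.Ideal.MinimalPrime.Noetherian
import Mathlib.RingTheory.Smooth.Flat
import Mathlib.LinearAlgebra.TensorProduct.Pi
import HarnessLib

/-!
# A scheme smooth over a reduced Noetherian scheme is reduced

Topic: `Literature/AlgebraicGeometry/Resolution`. Generic commutative algebra serving de Jong
1996, 4.15 (`AlterationsStrictTransform.lean`: "(vi) e) holds since `φ⁻¹(sm(X/Y)) ⊂ sm(X'/Y')`"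
— the base change `X ×_Y Y'` is smooth over the reduced `Y'` on `pr_X⁻¹(sm(X/Y))`, hence
reduced there, so that its reduction `X'` coincides with it there). Everything is PROVED:

* `injective_pi_fractionRing_quotient_minimalPrimes` — a reduced Noetherian ring embeds into
  the (finite) product of the fraction fields of its quotients by minimal primes;
* `isReduced_of_flat_of_isReduced_tensor` — **if `A` is reduced Noetherian, `B` is a flat
  `A`-algebra and the fibres `B ⊗_A κ(𝔭)` at the minimal primes `𝔭` are reduced, then `B` is
  reduced** (`B ⊂ ∏ B ⊗_A κ(𝔭)` by flatness);
* `isReduced_of_smooth_of_isReduced` — **a smooth algebra over a reduced Noetherian ring is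
  reduced** (smooth algebras over fields are reduced,
  `Literature.AlgebraicGeometry.Motives.isReduced_of_smooth_of_field`, Stacks 056T);
* `isReduced_of_smooth_of_isReduced_base` — **a scheme smooth over a reduced locally Noetherian
  scheme is reduced** (Stacks 034E with 033B).

## Sources

* The Stacks Project, Tag 034E (descending reducedness along smooth morphisms: "if `S` is
  reduced, then `X` is reduced"), Tag 056T, Tag 00EW (minimal primes, nilradical).
-/

noncomputable section

open CategoryTheory AlgebraicGeometry TopologicalSpace TensorProduct

namespace Literature.AlgebraicGeometry.Resolution

universe u v

/-! ## Commutative algebra -/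

section Algebra

variable (A : Type u) [CommRing A]

/-- **A reduced Noetherian ring embeds into the product of the fraction fields of its quotients
by the (finitely many) minimal primes**: the kernel is the intersection of the minimal primes,
the nilradical. [cite: StacksProject, Tag 00EW] -/
theorem injective_pi_fractionRing_quotient_minimalPrimes [IsReduced A] :
    Function.Injective (RingHom.pi fun p : ↥(minimalPrimes A) =>
      (algebraMap (A ⧸ p.1) (FractionRing (A ⧸ p.1))).comp (Ideal.Quotient.mk p.1)) := by
  rw [injective_iff_map_eq_zero]
  intro a ha
  have hmem : ∀ p ∈ minimalPrimes A, a ∈ p := by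
    intro p hp
    have h1 : algebraMap (A ⧸ p) (FractionRing (A ⧸ p)) (Ideal.Quotient.mk p a) = 0 :=
      congrFun ha ⟨p, hp⟩
    rw [map_eq_zero_iff _ (IsFractionRing.injective (A ⧸ p) (FractionRing (A ⧸ p))),
      Ideal.Quotient.eq_zero_iff_mem] at h1
    exact h1
  have hrad : a ∈ sInf (minimalPrimes A) := Ideal.mem_sInf.mpr hmem
  rw [minimalPrimes, Ideal.sInf_minimalPrimes] at hrad
  have : a ∈ nilradical A := hrad
  rwa [nilradical_eq_zero, Submodule.zero_eq_bot, Ideal.mem_bot] at this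

variable (B : Type v) [CommRing B] [Algebra A B]

/-- **Flat algebras with reduced fibres over the minimal primes of a reduced Noetherian ring are
reduced**: for `A` reduced Noetherian with minimal primes `𝔭ᵢ` and `κᵢ = Frac(A/𝔭ᵢ)`, and `B`
a flat `A`-algebra with all `B ⊗_A κᵢ` reduced, `B` is reduced — `B = B ⊗_A A ⊂ B ⊗_A ∏ κᵢ =
∏ B ⊗_A κᵢ` by flatness. [cite: StacksProject, Tag 034E] -/
theorem isReduced_of_flat_of_isReduced_tensor [IsNoetherianRing A] [IsReduced A] [Module.Flat A B]
    (h : ∀ p : ↥(minimalPrimes A), IsReduced (B ⊗[A] FractionRing (A ⧸ p.1))) : IsReduced B := by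
  classical
  haveI : Finite ↥(minimalPrimes A) := (minimalPrimes.finite_of_isNoetherianRing A).to_subtype
  letI : Fintype ↥(minimalPrimes A) := Fintype.ofFinite _
  -- the embedding `A → K = ∏ κᵢ` and its base change `B → B ⊗_A K`, injective by flatness
  let K : ↥(minimalPrimes A) → Type u := fun p => FractionRing (A ⧸ p.1)
  let φ : A →ₐ[A] (∀ p, K p) :=
    { RingHom.pi fun p : ↥(minimalPrimes A) =>
        (algebraMap (A ⧸ p.1) (FractionRing (A ⧸ p.1))).comp (Ideal.Quotient.mk p.1) with
      commutes' := fun a => rfl }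
  have hφ : Function.Injective φ := injective_pi_fractionRing_quotient_minimalPrimes A
  have hφB : Function.Injective (φ.toLinearMap.lTensor B) :=
    Module.Flat.lTensor_preserves_injective_linearMap _ hφ
  refine ⟨fun b hb => ?_⟩
  -- `b ⊗ 1 ↦ (b ⊗ 1)ᵢ`, nilpotent in each reduced `B ⊗ κᵢ`, hence zero
  have h1 : (TensorProduct.piRight A A B K) (b ⊗ₜ[A] (1 : ∀ p, K p)) = 0 := by
    funext p
    rw [TensorProduct.piRight_apply, TensorProduct.piRightHom_tmul]
    haveI := h p
    have hnil : IsNilpotent ((b ⊗ₜ[A] (1 : K p)) : B ⊗[A] K p) := by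
      obtain ⟨n, hn⟩ := hb
      refine ⟨n, ?_⟩
      have : (b ⊗ₜ[A] (1 : K p) : B ⊗[A] K p) = Algebra.TensorProduct.includeLeft (S := A) b := rfl
      rw [this, ← map_pow, hn, map_zero]
    exact hnil.eq_zero
  have h2 : b ⊗ₜ[A] (1 : ∀ p, K p) = 0 := by
    have := congrArg (TensorProduct.piRight A A B K).symm h1
    rwa [LinearEquiv.symm_apply_apply, map_zero] at this
  -- `b ⊗ 1 = (φ ⊗ B) (b ⊗ 1)` and `b ⊗ 1 ∈ B ⊗_A A` corresponds to `b`
  have h3 : φ.toLinearMap.lTensor B (b ⊗ₜ[A] (1 : A)) = b ⊗ₜ[A] (1 : ∀ p, K p) := by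
    rw [LinearMap.lTensor_tmul]
    congr 1
    exact map_one φ
  have h4 : b ⊗ₜ[A] (1 : A) = 0 := hφB (by rw [h3, h2, map_zero])
  have h5 := congrArg (TensorProduct.rid A B) h4
  rwa [TensorProduct.rid_tmul, one_smul, map_zero] at h5

/-- **A smooth algebra over a reduced Noetherian ring is reduced**: it is flat, and its fibres
over the minimal primes are smooth over fields, hence reduced
(`Literature.AlgebraicGeometry.Motives.isReduced_of_smooth_of_field`, Stacks 056T).
[cite: StacksProject, Tag 034E] -/
theorem isReduced_of_smooth_of_isReduced [IsNoetherianRing A] [IsReduced A] [Algebra.Smooth A B] :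
    IsReduced B := by
  refine isReduced_of_flat_of_isReduced_tensor A B fun p => ?_
  haveI : p.1.IsPrime := p.2.1.1
  -- `B ⊗_A κ ≅ κ ⊗_A B` is smooth over the field `κ = Frac(A/𝔭)`
  haveI : IsReduced (FractionRing (A ⧸ p.1) ⊗[A] B) :=
    Literature.AlgebraicGeometry.Motives.isReduced_of_smooth_of_field (FractionRing (A ⧸ p.1)) _
  exact isReduced_of_injective
    (Algebra.TensorProduct.comm A B (FractionRing (A ⧸ p.1))).toRingHom
    (Algebra.TensorProduct.comm A B (FractionRing (A ⧸ p.1))).injective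

end Algebra

/-! ## Schemes -/

section Schemes

variable {W Y : Scheme.{u}} (g : W ⟶ Y)

/-- **A scheme smooth over a reduced locally Noetherian scheme is reduced** (Stacks 034E): on
affine charts `Spec B → Spec A` with `A → B` smooth and `A` reduced Noetherian, `B` is reduced
(`isReduced_of_smooth_of_isReduced`); so all local rings of `W` are reduced.
[cite: StacksProject, Tag 034E] -/
theorem isReduced_of_smooth_of_isReduced_base [Smooth g] [IsReduced Y] [IsLocallyNoetherian Y] :
    IsReduced W := by
  haveI hst : ∀ x : W, _root_.IsReduced (W.presheaf.stalk x) := by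
    intro x
    obtain ⟨_, ⟨U, hU, rfl⟩, hxU, -⟩ :=
      Y.isBasis_affineOpens.exists_subset_of_mem_open (Set.mem_univ (g x)) isOpen_univ
    obtain ⟨_, ⟨V, hV, rfl⟩, hxV, hVU⟩ :=
      W.isBasis_affineOpens.exists_subset_of_mem_open hxU (U.2.preimage g.continuous)
    have hsm := g.smooth_appLE hU hV hVU
    algebraize [(g.appLE U V hVU).hom]
    haveI : IsNoetherianRing Γ(Y, U) := IsLocallyNoetherian.component_noetherian ⟨U, hU⟩
    haveI : _root_.IsReduced Γ(W, V) := isReduced_of_smooth_of_isReduced Γ(Y, U) Γ(W, V)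
    letI := W.presheaf.algebra_section_stalk (⟨x, hxV⟩ : V)
    haveI := hV.isLocalization_stalk ⟨x, hxV⟩
    exact isReduced_localizationPreserves (hV.primeIdealOf ⟨x, hxV⟩).asIdeal.primeCompl _
      inferInstance
  exact isReduced_of_isReduced_stalk W

end Schemes

end Literature.AlgebraicGeometry.Resolution

end
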